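import Literature.AlgebraicGeometry.Motives.MonomialSupportedHypersurfaceFamily
import Literature.AlgebraicGeometry.HodgeTheory.DirectImageBaseChangeSections
import Literature.AlgebraicGeometry.HodgeTheory.QuasiProjectiveOfAffine
import HarnessLib

/-!
# The monomial-supported family of smooth hypersurfaces: points in coefficient coordinates,
# quasi-projectivity, Ehresmann local triviality, polynomial avoidance

Family `hodge`, layer `Literature/AlgebraicGeometry/HodgeTheory`; theorems only (no definition, no
named fact). Companion of `Motives/MonomialSupportedHypersurfaceFamily` (definition request
`defn-MonomialSupportedHypersurfaceFamily`, crux K1-B `stub_signPencilOrbitData` of route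
SignSymmetricPowers): for a set `M` of degree-`d` monomials in `x₀, …, x_{n+1}` the family
`familyM k n d M : totalM ⟶ baseM` of smooth hypersurfaces supported on `M`, its base
`S_M = baseM k n d M` (nonsingular `M`-supported forms, open in `𝔸^M = Spec k[a_m | m ∈ M]`), the
point `pointOfFormM` of a nonsingular `M`-supported form and the coefficient homomorphism `pointHomM`.

## Contents

* §1 (any field `k`, `k`-rational points): the underlying point of `𝔸^M` of `t ∈ S_M(k)` is the
  kernel of its coefficient homomorphism (`ι_baseM_pt_eq_comap`), so **a set `W ⊆ S_M(k)` which is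
  Zariski closed on points is cut out, on the points `[G]` of nonsingular `M`-supported forms, by
  polynomials in ALL the coefficients `(coeff_m G)_{|m| = d}`** (`exists_polynomials_baseM`); the
  **avoidance polynomial of the discriminant** (`exists_avoidance_polynomial`: one coefficient
  polynomial `g₀`, non-zero at a given nonsingular form, whose non-vanishing forces nonsingularity);
  and the consumer's clause **(ALG)** (`alg_baseM`, `alg_baseM_classifyingPoint`): a proper
  Zariski-closed `W ⊊ S_M(k)` is avoided by every `M`-supported form of degree `d` off ONE
  polynomial condition `G ≠ 0` on the coefficients, `G` non-zero at some `M`-supported form, and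
  `G ≠ 0` already forces nonsingularity (pattern of `CyclicCoverReflectionMonodromy.CarlsonToledoFamily.alg`).
* §2 (`k = ℂ`): `S_M` is quasi-projective over `ℂ` (`isQuasiProjectiveOver_baseM`: open in the
  affine space `𝔸^M`, `IsQuasiProjectiveOver.of_isAffine`), and **`Rᵏ(π_M)_*` is a local system on
  all of `S_M(ℂ)`** (`isCohomologicallyLocallyTrivialOn_familyM`, Ehresmann over the smooth base:
  `isCohomologicallyLocallyTrivialOn_univ_of_isSmoothProjectiveFamily_of_smooth`).

## References

* C. Voisin, *Hodge Theory and Complex Algebraic Geometry II* (2003), §6.2.1 (`B ⊂ H⁰(X, 𝒪_X(Y))`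
  the Zariski open set of nonsingular members; the universal smooth hypersurface).
  [VoisinHodgeII2003]
* C. Voisin, *Hodge Theory and Complex Algebraic Geometry I* (2002), §9.1.1, Thm. 9.3 (Ehresmann),
  §9.2.1 (the local systems `Rᵏπ_*A`). [VoisinHodgeI2002]
* J. Carlson, D. Toledo, Discriminant complements and kernels of monodromy representations, Duke
  Math. J. 97 (1999), §2 (genericity in the space of forms). [CarlsonToledo1999]
* R. Hartshorne, *Algebraic Geometry* (1977), I Ex. 5.8, II §4 (quasi-projective), III §10.
  [Hartshorne1977]
-/

noncomputable section

open CategoryTheory AlgebraicGeometry MvPolynomial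
open Literature.AlgebraicGeometry.Motives
open Literature.AlgebraicGeometry.Motives.UniversalHypersurface

universe u

namespace Literature.AlgebraicGeometry.HodgeTheory.UniversalHypersurface

/-! ### §1 Rational points of `S_M` in coefficient coordinates -/

section CoeffVector

variable (k : Type u) [Field k] (n d : ℕ) (M : Set (DegIndex n d))

/-- The coefficient homomorphism of a `k`-point of `S_M` is evaluation at its coefficient vector
`m ↦ t(a_m)` (it is a `k`-algebra map, `pointHomM_comp_algebraMap`). [cite: VoisinHodgeII2003, §6.2.1] -/
theorem pointHomM_hom_eq_eval (t : AlgPoints (baseM k n d M) k) :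
    (pointHomM k n d M t).hom = eval (fun m => (pointHomM k n d M t).hom (X m)) := by
  refine MvPolynomial.ringHom_ext (fun r => ?_) (fun m => ?_)
  · have h := congrArg (fun φ : k →+* k => φ r) (pointHomM_comp_algebraMap k n d M t)
    simp only [RingHom.comp_apply, Algebra.algebraMap_self, RingHom.id_apply] at h
    rw [MvPolynomial.algebraMap_eq] at h
    rw [h, eval_C]
  · rw [eval_X]

/-- **The point of `𝔸^M` under a `k`-point `t` of `S_M`** is the contraction of the closed point of
`Spec k` along the coefficient homomorphism, i.e. the kernel of `pointHomM t` (`Spec_map_pointHomM`).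
[cite: VoisinHodgeII2003, §6.2.1] -/
theorem ι_baseM_pt_eq_comap (t : AlgPoints (baseM k n d M) k) :
    (baseMOpens k n d M).ι.base t.pt =
      PrimeSpectrum.comap (pointHomM k n d M t).hom (IsLocalRing.closedPoint k) := by
  show (t.left ≫ (baseMOpens k n d M).ι).base (IsLocalRing.closedPoint k) = _
  rw [← Spec_map_pointHomM]
  rfl

/-- For a ring homomorphism `φ : R → k` to a field, the contraction of the closed point lies on
`V(S)` iff `φ` kills `S`. [folklore] -/
private theorem comap_closedPoint_mem_zeroLocus_iff {R : Type u} [CommRing R] (φ : R →+* k)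
    (S : Set R) :
    PrimeSpectrum.comap φ (IsLocalRing.closedPoint k) ∈ PrimeSpectrum.zeroLocus S ↔
      ∀ F ∈ S, φ F = 0 := by
  rw [PrimeSpectrum.mem_zeroLocus]
  refine forall₂_congr fun F _ => ?_
  change φ F ∈ IsLocalRing.maximalIdeal k ↔ _
  rw [IsLocalRing.mem_maximalIdeal, mem_nonunits_iff, isUnit_iff_ne_zero, not_not]

/-- **A `k`-point `t ∈ S_M(k)` lies over the Zariski closed set `V(S) ⊆ 𝔸^M` iff every member of `S`
is killed by its coefficient homomorphism.** [cite: VoisinHodgeII2003, §6.2.1] -/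
theorem ι_baseM_pt_mem_zeroLocus_iff (t : AlgPoints (baseM k n d M) k) (S : Set (CoeffRingM k n d M)) :
    (baseMOpens k n d M).ι.base t.pt ∈ PrimeSpectrum.zeroLocus S ↔
      ∀ F ∈ S, (pointHomM k n d M t).hom F = 0 := by
  rw [ι_baseM_pt_eq_comap]
  exact comap_closedPoint_mem_zeroLocus_iff k (pointHomM k n d M t).hom S

/-- **A subset of `S_M(k)` which is Zariski closed on points is cut out by coefficient polynomials**:
`W = {t | F(t(a)) = 0 ∀ F ∈ S}` for some `S ⊆ R_M` (`S_M ⊆ 𝔸^M` is a topological embedding and closed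
subsets of `𝔸^M = Spec R_M` are the `V(S)`). [cite: VoisinHodgeII2003, §6.2.1] -/
theorem exists_forall_mem_iff_of_isZariskiClosedOnPoints (W : Set (AlgPoints (baseM k n d M) k))
    (hW : IsZariskiClosedOnPoints (baseM k n d M) W) :
    ∃ S : Set (CoeffRingM k n d M), ∀ t : AlgPoints (baseM k n d M) k,
      t ∈ W ↔ ∀ F ∈ S, (pointHomM k n d M t).hom F = 0 := by
  obtain ⟨Zc, hZc, rfl⟩ := hW
  have hind : Topology.IsInducing (baseMOpens k n d M).ι.base :=
    (baseMOpens k n d M).ι.isOpenEmbedding.isInducing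
  obtain ⟨Cl, hCl, hZcCl⟩ := hind.isClosed_iff.mp hZc
  obtain ⟨S, rfl⟩ := (PrimeSpectrum.isClosed_iff_zeroLocus Cl).mp hCl
  refine ⟨S, fun t => ?_⟩
  have h1 : t ∈ {P : AlgPoints (baseM k n d M) k | P.pt ∈ Zc} ↔
      (baseMOpens k n d M).ι.base t.pt ∈ PrimeSpectrum.zeroLocus S := by
    rw [← hZcCl]
    rfl
  rw [h1, ι_baseM_pt_mem_zeroLocus_iff]

/-- The coefficient homomorphism of the point `[G]` is `a_m ↦ coeff_m G` (`m ∈ M`).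
[cite: VoisinHodgeII2003, §6.2.1] -/
theorem pointHomM_pointOfFormM {G : MvPolynomial (Fin (n + 2)) k} (hG : G.IsHomogeneous d)
    (hJ : SmoothHypersurface.IsNonsingularForm k G) (hM : IsSupportedOn n d M G) :
    pointHomM k n d M (pointOfFormM k n d M hG hJ hM) =
      CommRingCat.ofHom (coeffHomM k n d M G).toRingHom := by
  apply Spec.map_injective
  rw [Spec_map_pointHomM]
  exact pointOfFormM_left_comp_ι k n d M hG hJ hM

/-- Reading a polynomial in the `M`-coefficients as a polynomial in all coefficients: evaluating
`rename (↑) F` at the full coefficient vector of `G` is evaluating `F` at the `M`-coefficients, i.e.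
applying `coeffHomM G`. [folklore] -/
private theorem eval_coeff_rename_val (G : MvPolynomial (Fin (n + 2)) k) (F : CoeffRingM k n d M) :
    MvPolynomial.eval (fun m : DegIndex n d => coeff m.1 G) (rename (fun m : M => (m : DegIndex n d)) F) =
      (coeffHomM k n d M G) F := by
  simp only [eval_rename, coeffHomM, Function.comp_def]
  rfl

/-- **Zariski-closed subsets of `S_M(k)` are cut out, on classified forms, by polynomials in ALL the
coefficients `(coeff_m G)_{|m| = d}`** (the clause `exists_polynomials` of
`CyclicCoverReflectionMonodromy.CarlsonToledoFamily`, here PROVED for the `M`-supported family): for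
`W ⊆ S_M(k)` Zariski closed on points there is a set `𝒢` of coefficient polynomials such that the point
`[G]` of a nonsingular `M`-supported form `G` of degree `d` lies in `W` iff every member of `𝒢` vanishes
at the coefficient vector of `G`. [cite: CarlsonToledo1999, §2] -/
theorem exists_polynomials_baseM (W : Set (AlgPoints (baseM k n d M) k))
    (hW : IsZariskiClosedOnPoints (baseM k n d M) W) :
    ∃ 𝒢 : Set (MvPolynomial (DegIndex n d) k), ∀ (G : MvPolynomial (Fin (n + 2)) k)
      (hG : G.IsHomogeneous d) (hJ : SmoothHypersurface.IsNonsingularForm k G)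
      (hM : IsSupportedOn n d M G),
      pointOfFormM k n d M hG hJ hM ∈ W ↔
        ∀ g ∈ 𝒢, MvPolynomial.eval (fun m : DegIndex n d => coeff m.1 G) g = 0 := by
  obtain ⟨S, hS⟩ := exists_forall_mem_iff_of_isZariskiClosedOnPoints k n d M W hW
  refine ⟨rename (fun m : M => (m : DegIndex n d)) '' S, fun G hG hJ hM => ?_⟩
  rw [hS, Set.forall_mem_image, pointHomM_pointOfFormM k n d M hG hJ hM, CommRingCat.hom_ofHom]
  refine forall₂_congr fun F _ => ?_
  rw [eval_coeff_rename_val, AlgHom.toRingHom_eq_coe, AlgHom.coe_toRingHom]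

/-- The point `[G] ∈ Spec R` (image of `Spec k` under `a_m ↦ coeff_m G`): a coefficient polynomial `g`
lies in its prime iff `g(coeff G) = 0`. [folklore] -/
private theorem mem_asIdeal_specMap_coeffHom_iff (G : MvPolynomial (Fin (n + 2)) k) (y : Spec (.of k))
    (g : CoeffRing k n d) :
    g ∈ ((Spec.map (CommRingCat.ofHom (coeffHom k n d G).toRingHom)).base y).asIdeal ↔
      MvPolynomial.eval (fun m : DegIndex n d => coeff m.1 G) g = 0 := by
  rw [Spec.map_base]
  change MvPolynomial.eval (fun m : DegIndex n d => coeff m.1 G) g ∈ y.asIdeal ↔ _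
  rw [Ideal.eq_bot_of_prime y.asIdeal, Ideal.mem_bot]

/-- **Nonsingularity is general, with an explicit avoidance polynomial**: given one nonsingular form
`Φ` of degree `d`, there is a coefficient polynomial `g₀` with `g₀(coeff Φ) ≠ 0` such that every
degree-`d` form `G` with `g₀(coeff G) ≠ 0` is nonsingular (`g₀` = an element of the ideal of the closed
discriminant `S^d ∖ U` not vanishing at `[Φ]`; Voisin II §6.2.1: "`B` … the Zariski open set
consisting of the polynomials `f` such that the hypersurface … is smooth"). [cite: VoisinHodgeII2003, §6.2.1] -/
theorem exists_avoidance_polynomial {Φ : MvPolynomial (Fin (n + 2)) k} (hΦ : Φ.IsHomogeneous d)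
    (hJΦ : SmoothHypersurface.IsNonsingularForm k Φ) :
    ∃ g₀ : CoeffRing k n d,
      MvPolynomial.eval (fun m : DegIndex n d => coeff m.1 Φ) g₀ ≠ 0 ∧
      ∀ G : MvPolynomial (Fin (n + 2)) k, G.IsHomogeneous d →
        MvPolynomial.eval (fun m : DegIndex n d => coeff m.1 G) g₀ ≠ 0 →
          SmoothHypersurface.IsNonsingularForm k G := by
  classical
  obtain ⟨I, hI⟩ :=
    (PrimeSpectrum.isClosed_iff_zeroLocus_ideal _).mp (isClosed_discriminantSet k n d)
  let y₀ : Spec (.of k) := IsLocalRing.closedPoint k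
  have hΦU : (Spec.map (CommRingCat.ofHom (coeffHom k n d Φ).toRingHom)).base y₀ ∉
      discriminantSet k n d :=
    (mem_baseOpens_iff k n d _).mp (specMap_coeffHom_apply_mem_baseOpens k n d hΦ hJΦ y₀)
  rw [hI] at hΦU
  obtain ⟨g₀, hg₀I, hg₀Φ⟩ : ∃ g₀ ∈ I,
      g₀ ∉ ((Spec.map (CommRingCat.ofHom (coeffHom k n d Φ).toRingHom)).base y₀).asIdeal := by
    by_contra! h
    exact hΦU h
  refine ⟨g₀, fun h => hg₀Φ ((mem_asIdeal_specMap_coeffHom_iff k n d Φ y₀ g₀).mpr h),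
    fun G hG hGg => ?_⟩
  -- every point `[G]` with `g₀(coeff G) ≠ 0` lies in `U`, so `[G]` is a `k`-point of `U` with form `G`
  have hGU : ∀ y : Spec (.of k),
      (Spec.map (CommRingCat.ofHom (coeffHom k n d G).toRingHom)).base y ∈ baseOpens k n d := by
    intro y
    rw [mem_baseOpens_iff, hI]
    intro hmem
    exact hGg ((mem_asIdeal_specMap_coeffHom_iff k n d G y g₀).mp (hmem hg₀I))
  let P : Spec (.of k) ⟶ (baseOpens k n d).toScheme :=
    IsOpenImmersion.lift (baseOpens k n d).ι
      (Spec.map (CommRingCat.ofHom (coeffHom k n d G).toRingHom))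
      (by
        rintro _ ⟨y, rfl⟩
        rw [Scheme.Opens.range_ι]
        exact hGU y)
  have hP : P ≫ (baseOpens k n d).ι = Spec.map (CommRingCat.ofHom (coeffHom k n d G).toRingHom) :=
    IsOpenImmersion.lift_fac _ _ _
  let s : AlgPoints (base k n d) k :=
    AlgPoints.mk (X := base k n d) P
      (by
        have hc : (coeffHom k n d G).toRingHom.comp (algebraMap k (CoeffRing k n d)) =
            algebraMap k k :=
          RingHom.ext fun r => (coeffHom k n d G).commutes r
        change (P ≫ (baseOpens k n d).ι) ≫ specCoeffToSpec k n d = _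
        rw [hP, ← Spec.map_comp, ← CommRingCat.ofHom_comp, hc])
  have hhom : pointHom k n d s = CommRingCat.ofHom (coeffHom k n d G).toRingHom := by
    apply Spec.map_injective
    rw [Spec_map_pointHom]
    exact hP
  have hsG : pointForm k n d s = G := by
    rw [pointForm, hhom, CommRingCat.hom_ofHom]
    exact map_coeffHom_universalForm k n d G hG
  simpa only [hsG] using isNonsingularForm_pointForm k n d s

/-- **The genericity clause (ALG) for the `M`-supported family**: a Zariski-closed (on points) subset
`W ≠ S_M(k)` is avoided by the point `[f]` of every `M`-supported form `f` of degree `d` off ONE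
polynomial condition `G(coeff f) ≠ 0` on the coefficients — a condition which already forces `f` to be
nonsingular — and `G` does not vanish at some `M`-supported form of degree `d` (so `{G ≠ 0}` is a dense
open subset of `𝔸^M`). From `exists_polynomials_baseM`, `pointOfFormM_pointFormM` (a point outside `W`
is classified by its own form) and `exists_avoidance_polynomial`; the pattern of
`CarlsonToledoFamily.alg`. [cite: CarlsonToledo1999, §2] -/
theorem alg_baseM (W : Set (AlgPoints (baseM k n d M) k)) (hW : IsZariskiClosedOnPoints (baseM k n d M) W)
    (hW' : W ≠ Set.univ) :
    ∃ G : MvPolynomial (DegIndex n d) k,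
      (∃ f : MvPolynomial (Fin (n + 2)) k, f.IsHomogeneous d ∧ IsSupportedOn n d M f ∧
        MvPolynomial.eval (fun m : DegIndex n d => coeff m.1 f) G ≠ 0) ∧
      ∀ f : MvPolynomial (Fin (n + 2)) k, f.IsHomogeneous d → IsSupportedOn n d M f →
        MvPolynomial.eval (fun m : DegIndex n d => coeff m.1 f) G ≠ 0 →
          SmoothHypersurface.IsNonsingularForm k f ∧
            ∀ (hf : f.IsHomogeneous d) (hJ : SmoothHypersurface.IsNonsingularForm k f)
              (hM : IsSupportedOn n d M f), pointOfFormM k n d M hf hJ hM ∉ W := by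
  obtain ⟨𝒢, h𝒢⟩ := exists_polynomials_baseM k n d M W hW
  obtain ⟨t, ht⟩ := (Set.ne_univ_iff_exists_notMem W).mp hW'
  -- the form of `t` and its polynomials
  have hf₀ := isHomogeneous_pointForm k n d (AlgPoints.map (toBase k n d M) t)
  have hJ₀ := isNonsingularForm_pointForm k n d (AlgPoints.map (toBase k n d M) t)
  have hM₀ := isSupportedOn_pointFormM k n d M t
  have ht' : pointOfFormM k n d M hf₀ hJ₀ hM₀ ∉ W := by
    rwa [pointOfFormM_pointFormM k n d M t]
  have h : ¬ ∀ g ∈ 𝒢, MvPolynomial.eval (fun m : DegIndex n d => (pointFormM k n d M t).coeff m.1) g = 0 :=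
    fun h => ht' ((h𝒢 _ hf₀ hJ₀ hM₀).mpr h)
  simp only [not_forall] at h
  obtain ⟨g, hg, hg0⟩ := h
  obtain ⟨g₀, hg₀0, hg₀⟩ := exists_avoidance_polynomial k n d hf₀ hJ₀
  refine ⟨g * g₀, ⟨pointFormM k n d M t, hf₀, hM₀, ?_⟩, fun f hf hM hGf => ?_⟩
  · rw [map_mul]
    exact mul_ne_zero hg0 hg₀0
  · rw [map_mul] at hGf
    have hJ : SmoothHypersurface.IsNonsingularForm k f := hg₀ f hf (right_ne_zero_of_mul hGf)
    exact ⟨hJ, fun hf' hJ' hM' hmem => (left_ne_zero_of_mul hGf) ((h𝒢 f hf' hJ' hM').mp hmem g hg)⟩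

/-- (ALG) for the total classifying map `classifyingPoint t₀` (junk value `t₀` on bad forms): the same
polynomial `G` works, since on the forms in question the classifying map is `pointOfFormM`
(`classifyingPoint_eq`). [cite: CarlsonToledo1999, §2] -/
theorem alg_baseM_classifyingPoint (t₀ : AlgPoints (baseM k n d M) k)
    (W : Set (AlgPoints (baseM k n d M) k)) (hW : IsZariskiClosedOnPoints (baseM k n d M) W)
    (hW' : W ≠ Set.univ) :
    ∃ G : MvPolynomial (DegIndex n d) k,
      (∃ f : MvPolynomial (Fin (n + 2)) k, f.IsHomogeneous d ∧ IsSupportedOn n d M f ∧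
        MvPolynomial.eval (fun m : DegIndex n d => coeff m.1 f) G ≠ 0) ∧
      ∀ f : MvPolynomial (Fin (n + 2)) k, f.IsHomogeneous d → IsSupportedOn n d M f →
        MvPolynomial.eval (fun m : DegIndex n d => coeff m.1 f) G ≠ 0 →
          SmoothHypersurface.IsNonsingularForm k f ∧ classifyingPoint k n d M t₀ f ∉ W := by
  obtain ⟨G, hG, hG'⟩ := alg_baseM k n d M W hW hW'
  refine ⟨G, hG, fun f hf hM hGf => ?_⟩
  obtain ⟨hJ, h⟩ := hG' f hf hM hGf
  refine ⟨hJ, ?_⟩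
  rw [classifyingPoint_eq k n d M t₀ hf hJ hM]
  exact h hf hJ hM

end CoeffVector

/-! ### §2 Over `ℂ`: quasi-projectivity and Ehresmann local triviality -/

section Complex

variable (n d : ℕ) (M : Set (DegIndex n d))

/-- **`S_M` is quasi-projective over `ℂ`**: an open subscheme (`S_M ⊆ 𝔸^M`, open immersion) of the
affine space `𝔸^M = Spec ℂ[a_m | m ∈ M]`, which is affine of finite type hence quasi-projective
(`IsQuasiProjectiveOver.of_isAffine`; Hartshorne II §4, p. 103). [cite: Hartshorne1977, II §4 Definition (quasi-projective), p. 103] -/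
theorem isQuasiProjectiveOver_baseM : IsQuasiProjectiveOver (baseM ℂ n d M) := by
  let A : SchemeOver ℂ := specOver ℂ (CoeffRingM ℂ n d M)
  haveI : IsAffine A.left := inferInstanceAs (IsAffine (Spec _))
  haveI : LocallyOfFiniteType A.hom := by
    haveI := smoothOfRelativeDimension_specMToSpec ℂ n d M
    haveI : Smooth (specMToSpec ℂ n d M) := SmoothOfRelativeDimension.smooth (Nat.card M) _
    change LocallyOfFiniteType (specMToSpec ℂ n d M)
    infer_instance
  obtain ⟨P, j, hP, hj⟩ := IsQuasiProjectiveOver.of_isAffine A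
  let i : baseM ℂ n d M ⟶ A := Over.homMk (baseMOpens ℂ n d M).ι rfl
  haveI : IsOpenImmersion i.left := inferInstanceAs (IsOpenImmersion (baseMOpens ℂ n d M).ι)
  haveI := hj
  refine ⟨P, i ≫ j, hP, ?_⟩
  rw [Over.comp_left]
  infer_instance

/-- **Ehresmann for the `M`-supported family**: for `n ≥ 1`, `d ≥ 1` the smooth projective family
`π_M : 𝒴_M → S_M` over the smooth base `S_M` is cohomologically locally trivial on all of `S_M(ℂ)` —
`s ↦ Hᵏ(𝒴_{M,s}(ℂ); ℚ)` is a local system on `S_M(ℂ)` (Voisin I, Thm. 9.3 and §9.2.1; the tree's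
`isCohomologicallyLocallyTrivialOn_univ_of_isSmoothProjectiveFamily_of_smooth`), so the monodromy
groups `ratMonodromyGroup (familyM ℂ n d M) k _ s` are defined at every point.
[cite: VoisinHodgeI2002, Thm. 9.3 and §9.2.1] -/
theorem isCohomologicallyLocallyTrivialOn_familyM (hn : 1 ≤ n) (hd : 1 ≤ d) :
    IsCohomologicallyLocallyTrivialOn (familyM ℂ n d M) (Set.univ : Set (ComplexPoints (baseM ℂ n d M))) :=
  haveI := smooth_baseM_hom ℂ n d M
  isCohomologicallyLocallyTrivialOn_univ_of_isSmoothProjectiveFamily_of_smooth (familyM ℂ n d M)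
    (isSmoothProjectiveFamily_familyM ℂ n d M hn hd)

end Complex

end Literature.AlgebraicGeometry.HodgeTheory.UniversalHypersurface

end
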